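import Summits.CriticalPhenomena.PercolationContinuityZ3.Theorems.Transplant.D10SKc11_0255P2
import HarnessLib

/-!
# Diamond film `D_10` — KERNEL CERTIFICATE for the class `11_0255` of `ShapedLinkageX 4 (DiamondFilm.sqShadow (k := 10))`, THE CLASS (mask + coverage from the 2 parts) (template `fullmcp`, |W| = 158, 1406 terminal pairs, 4107 plans)

builds on p205010 (kernel theorem, internal audit signed; external expert review pending) — NOT used in this file.  Lane `prim-bschramm`, seat `prim-bschramm-p2` (gen 43; class C1b;
memo `HOME/bschramm/P2-LATTICES.md` §152); helper file (`--supports stmt-CriticalPhenomena-4575 --as helper`).  Generated by `cert/emit_dk.py` from the plans of `cert/gen_dk.py`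
(canonical BFS routings with avoid hints, exact mirror `cert/kern_dk.py` of «DkSKDefs»); re-checked here by the kernel (`DCtx.checkEs`); `caseOK_k10_11_0255` feeds «D10SKFinal».
[cite: DuminilCopinSidoraviciusTassion2016, §2.3 (proof of Fact 2: the three disjoint paths in B_R(z))]
-/

namespace Summit.CriticalPhenomena.PercolationContinuityZ3.Theorems.Transplant

namespace DiamondFilm.DK

/-- The cleared mask of the class `11_0255` of `D_10` is admissible (inside the cleared block, containing the forced core). [folklore] -/
theorem wOK_k10_11_0255 : DCtx.wOK (⟨10, 1, 1, 0, 2, 5, 5, 4887571048673222691877502061387249283044013419341172153524066706344193963578195306942016252017866911103917183975424⟩ : DCtx) = true := by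
  decide +kernel

/-- **THE CLASS `11_0255` OF `D_10` IS COVERED**: every needed bit of every certified terminal pair has a swap-pair plan. [cite: DuminilCopinSidoraviciusTassion2016, §2.3 (proof of Fact 2)] -/
theorem caseOK_k10_11_0255 : CaseOK (⟨10, 1, 1, 0, 2, 5, 5, 4887571048673222691877502061387249283044013419341172153524066706344193963578195306942016252017866911103917183975424⟩ : DCtx) :=
  caseOK_of_chunks _ [[14, 15, 16, 17], [18, 19, 20, 25], [33, 37, 45, 49], [57, 61, 69, 158], [159, 160, 161, 162], [163, 164, 169, 177], [181, 189, 193, 201], [205, 213, 302, 304], [306, 308, 326, 332], [350, 356]]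
    (List.forall_mem_cons.2 ⟨checkEs_sound _ _ _ chunk_k10_11_0255_0, List.forall_mem_cons.2 ⟨checkEs_sound _ _ _ chunk_k10_11_0255_1, List.forall_mem_cons.2 ⟨checkEs_sound _ _ _ chunk_k10_11_0255_2, List.forall_mem_cons.2 ⟨checkEs_sound _ _ _ chunk_k10_11_0255_3, List.forall_mem_cons.2 ⟨checkEs_sound _ _ _ chunk_k10_11_0255_4, List.forall_mem_cons.2 ⟨checkEs_sound _ _ _ chunk_k10_11_0255_5, List.forall_mem_cons.2 ⟨checkEs_sound _ _ _ chunk_k10_11_0255_6, List.forall_mem_cons.2 ⟨checkEs_sound _ _ _ chunk_k10_11_0255_7, List.forall_mem_cons.2 ⟨checkEs_sound _ _ _ chunk_k10_11_0255_8, List.forall_mem_cons.2 ⟨checkEs_sound _ _ _ chunk_k10_11_0255_9, List.forall_mem_nil _⟩⟩⟩⟩⟩⟩⟩⟩⟩⟩)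
    (by decide +kernel)

end DiamondFilm.DK

end Summit.CriticalPhenomena.PercolationContinuityZ3.Theorems.Transplant
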